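import Summits.BirchSwinnertonDyer.Rank1Residual.X11b.Three.GoodReductionSubgroupCuspPresentation
import Summits.BirchSwinnertonDyer.Rank1Residual.X11b.Three.GoodReductionSubgroupFormalInputs
import Summits.BirchSwinnertonDyer.Rank1Residual.X11b.Three.GoodReductionSubgroupValuation
import Literature.NumberTheory.EllipticCurves.IwasawaSelmerControlAwayFromPProofs
import HarnessLib

/-!
# `E₀(K)` at an ADDITIVE place is uniquely divisible by every integer prime to the residue
# characteristic; `E(K)[ℓ] ≠ 0 ⟺ [E(K) : E₀(K)] = ℓ` when the index is `1` or `ℓ`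
# (cell `b2b-bsdres`, lane CLASS-CLOSURE / class O6, cross-cell pool work of seat `b2b-bsdres-x11b3-p4`
# GEN 9; the local-group half of the TARGET `Additive.LocalThreeTorsionIffTamagawaThreeOfIV`; THEOREMS ONLY)

HONEST FRAMING (cell `b2b-bsdres`, run/shared/lean/b2b/bsd-rank1-residual/, verbatim in every
file): the goal of the cell is to DELETE the COMBINATION-SHAPED residual classes of the
Birch–Swinnerton-Dyer formula for ALL analytic-rank `≤ 1` elliptic curves over `ℚ` — "full BSD
formula for every rank `≤ 1` curve in class `C`" assembled STRICTLY from published theorems — so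
that the rank-`≤ 1` remainder becomes exactly the CONSTRUCTION-SHAPED classes, which are TYPED
(missing-input `Prop`s), NOT attempted. This is not "finishing BSD". This file: THEOREMS ONLY (no
definition, no named fact, no `sorry`, no `@[conjecture]` node); a LOCAL LEMMA of Silverman's
*AEC* / *ATAEC*, kernel-checked from tree theorems; nothing about any particular curve is asserted;
nothing is booked; no mark of `RESIDUAL-MAP.md` moves; O6 stays OPEN.

## What is proved

Let `R` be a complete discrete valuation ring with FINITE residue field `k`, `L = Frac R`, and
`W₀` a Weierstrass equation over `R` whose generic fibre `W₀ ⊗ L` is an elliptic curve with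
ADDITIVE reduction (Mathlib's `HasAdditiveReduction R`: `W₀` is `R`-minimal, `v(Δ) > 0`,
`v(c₄) > 0`, i.e. the reduction is a cusp). Let `N` be a natural number which is a UNIT of `R`
(prime to the residue characteristic). In the currency of `ReductionHomomorphism.lean`
(`E₁(L) = {P | W₀.ReducesToZero P}`, `E₀(L) = W₀.nonsingularReductionSubgroup hv`):

* `mem_kernel_iff_reducesToZero` — the chart kernel `FormalGroupChart.kernel w (W₀ ⊗ L)` of a
  compatible `ℝ≥0`-valuation `w` IS `E₁(L)` (bridge between the two tree currencies);
* `eq_zero_of_nsmul_eq_zero_of_reducesToZero` — **`E₁(L)[N] = 0`** (any DVR `R`; Silverman *AEC*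
  VII.3.1(a), by the tree's division-polynomial lemma `val_le_one_of_zsmul_eq_zero`);
* `exists_nsmul_eq_of_reducesToZero` — **`E₁(L) = N·E₁(L)`** for `R` complete (*AEC* IV.2.3(b),
  IV.3.2(b), VII.2.2: `[N]` is an automorphism of `Ê(𝔪)`), by the tree's successive approximation
  `FormalGroupChart.exists_nsmul_eq_of_complete` on the layer `⊤ ⊆ L`, whose analytic inputs
  (Hensel lift of parameters, completeness, discreteness) are the x11b3-p4 GEN 2 theorems
  `JetchevKummer.exists_mem_kernel_zCoord_eq` / `exists_limit_of_forall_val_sub_le_pow` /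
  `val_le_val_uniformizer_of_lt_one`;
* `eq_zero_of_nsmul_eq_zero_of_hasNonsingularReduction` — **`E₀(L)[N] = 0` at a cusp**
  (*ATAEC* IV.9 Rem. 9.2.2: `Ẽ_ns(k) ≅ k⁺` is killed by the residue characteristic), through the
  cusp homomorphism `r : E₀(L) →+ k` with kernel `E₁(L)` (x11b3-p4 GEN 2,
  `JetchevKummer.exists_addMonoidHom_of_map_eq_singularModel_cusp` with the presentation
  `exists_map_residue_eq_singularModel_cusp_of_hasAdditiveReduction`);
* `exists_nsmul_eq_of_hasNonsingularReduction` — **`E₀(L) = N·E₀(L)` at a cusp** (same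
  mechanism: `N · N^{#k-2} = N^{#k-1} = 1` in `k`, so `P − N·(N^{#k−2}·P) ∈ E₁(L) = N·E₁(L)`; no
  surjectivity of the reduction map is used);
* `AddSubgroup.exists_ne_zero_nsmul_eq_zero_iff_index_eq` — pure group theory: for `H ≤ G` with
  `H` `ℓ`-divisible and `ℓ`-torsion-free, `ℓ` prime, and `[G : H] ∈ {1, ℓ}`:
  `(∃ g ≠ 0, ℓ•g = 0) ⟺ [G : H] = ℓ`;
* **`exists_ne_zero_and_nsmul_eq_zero_iff_index_eq_of_hasAdditiveReduction`** (END) — for `W₀`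
  as above, a prime `ℓ` which is a unit of `R`, and `[E(L) : E₀(L)] ∈ {1, ℓ}`:
  **`E(L)` has a point of order `ℓ` iff `[E(L) : E₀(L)] = ℓ`.** At a Kodaira type `IV` / `IV*`
  place (`c ∈ {1, 3}`, tree `localTamagawaNumber_of_kodairaSymbolAt_eq_IV(_star)_holds`) and
  `ℓ = 3 ≠` residue characteristic this is the TARGET `Additive.LocalThreeTorsionIffTamagawaThreeOfIV`
  (o6-r1 GEN 9 / cc-typer-5 GEN 5, `Additive/FouquetWanPointTransport.lean`), assembled over
  `ℚ_[q]` in the sibling `Additive/LocalThreeTorsionIffTamagawaThreeOfIVHolds.lean`.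

References: J. H. Silverman, *The Arithmetic of Elliptic Curves*, 2nd ed. (2009), IV.2.3, IV.3.2,
VII.2.1–2.2, VII.3.1 [SilvermanAEC2009]; *Advanced Topics in the Arithmetic of Elliptic Curves*
(1994), IV.9 Remark 9.2.2, Cor. IV.9.2 [SilvermanATAEC1994].

## Design

No definitions; `noncomputable section`; `open scoped Classical NNReal`; universe `u` for `L` (the
layer lemmas of `FormalGroupChart` are universe-monomorphic in the pair `(E, L)`; here `E = L`).
The GEN-2 lemmas are stated for `X ⊗ L` with `X` over a subfield `F ⊆ L`; they are instantiated
at `F = L`, `X = W₀ ⊗ L` (`(W₀ ⊗ L) ⊗ L = W₀ ⊗ L` definitionally), the instances on `(W₀ ⊗ L) ⊗ L`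
being supplied by `haveI` from those on `W₀ ⊗ L`. Axioms: `propext`, `Classical.choice`,
`Quot.sound`.
-/

noncomputable section

open scoped Classical NNReal

/-! ### §0 Pure group theory: torsion of prime order versus an index in `{1, ℓ}` -/

namespace AddSubgroup

/-- **`G[ℓ] ≠ 0 ⟺ [G : H] = ℓ`** for a subgroup `H` of an abelian group `G` which is
`ℓ`-DIVISIBLE (`H = ℓ·H`) and has NO `ℓ`-torsion, `ℓ` a prime, when the index `[G : H]` is known to
be `1` or `ℓ`: if `g ≠ 0`, `ℓ•g = 0` then `g ∉ H`, so `H ≠ G` and the index is `ℓ`; conversely for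
`g ∉ H` one has `ℓ•g = [G:H]•g ∈ H = ℓ·H`, `ℓ•g = ℓ•h`, and `g − h ≠ 0` is killed by `ℓ`. (The
abstract form of "`E(K)[ℓ] ≅ Φ(k)[ℓ]` when `E₀(K)` is uniquely `ℓ`-divisible", Silverman *ATAEC*
IV.9 Rem. 9.2.2 / Cor. IV.9.2.) [folklore] -/
theorem exists_ne_zero_nsmul_eq_zero_iff_index_eq {G : Type*} [AddCommGroup G] (H : AddSubgroup G)
    {ℓ : ℕ} (hℓ : ℓ.Prime) (hdiv : ∀ g ∈ H, ∃ h ∈ H, ℓ • h = g)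
    (htf : ∀ g ∈ H, ℓ • g = 0 → g = 0) (hidx : H.index = 1 ∨ H.index = ℓ) :
    (∃ g : G, g ≠ 0 ∧ ℓ • g = 0) ↔ H.index = ℓ := by
  constructor
  · rintro ⟨g, hg0, hg⟩
    rcases hidx with h1 | hℓ'
    · exfalso
      have hmem : g ∈ H := by rw [AddSubgroup.index_eq_one.mp h1]; exact AddSubgroup.mem_top g
      exact hg0 (htf g hmem hg)
    · exact hℓ'
  · intro hℓ'
    have hne : H ≠ ⊤ := by
      intro htop
      have h1 : H.index = 1 := AddSubgroup.index_eq_one.mpr htop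
      rw [hℓ'] at h1
      exact hℓ.one_lt.ne' h1
    obtain ⟨g, hg⟩ : ∃ g : G, g ∉ H :=
      not_forall.mp (mt (AddSubgroup.eq_top_iff' H).mpr hne)
    have hℓg : ℓ • g ∈ H := by
      have := AddSubgroup.nsmul_index_mem H g
      rwa [hℓ'] at this
    obtain ⟨h, hh, hℓh⟩ := hdiv _ hℓg
    refine ⟨g - h, fun h0 ↦ hg ?_, by rw [smul_sub, hℓh, sub_self]⟩
    rw [sub_eq_zero] at h0
    rwa [h0]

end AddSubgroup

namespace Summit.BirchSwinnertonDyer.Rank1Residual.Additive.CuspDivision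

open WeierstrassCurve Literature.NumberTheory.EllipticCurves
  Literature.NumberTheory.EllipticCurves.FormalGroupChart
  Summit.BirchSwinnertonDyer.Rank1Residual.X11b.Three.JetchevKummer

universe u

variable {L : Type u} [Field L] (R : Type*) [CommRing R] [IsDomain R] [IsDiscreteValuationRing R]
  [Algebra R L] [IsFractionRing R L] (W₀ : WeierstrassCurve R)

/-! ### §1 The kernel of reduction `E₁(L)`: no `N`-torsion, `N`-divisible (`N` a unit of `R`) -/

omit [IsDomain R] [IsDiscreteValuationRing R] [IsFractionRing R L] in
/-- **The chart kernel is `E₁(L)`**: for an `ℝ≥0`-valuation `w` of `L` with valuation ring `R`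
(`hw`), an `L`-point of `W₀` lies in `FormalGroupChart.kernel w (W₀ ⊗ L)` (`|x| > 1`) iff it
reduces to `O` in the sense of `ReductionHomomorphism.lean` (`x ∉ R`). [folklore] -/
theorem mem_kernel_iff_reducesToZero {w : Valuation L ℝ≥0} (hw : w.Integers R)
    [(W₀.baseChange L).IsIntegral w.integer] (P : (W₀.baseChange L).toAffine.Point) :
    P ∈ kernel w (W₀.baseChange L) ↔ W₀.ReducesToZero P := by
  rcases P with _ | ⟨x, y, h⟩
  · exact ⟨fun _ ↦ reducesToZero_zero, fun _ ↦ (kernel w _).zero_mem⟩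
  · rw [some_mem_kernel_iff, reducesToZero_some_iff, not_mem_range_iff hw]

/-- **`E₁(L)` has no `N`-torsion for `N ∈ R^×`** (Silverman, *AEC* VII.3.1(a); the tree's
division-polynomial lemma `val_le_one_of_zsmul_eq_zero`: an affine point killed by `n` with
`|n| = 1` has `|x| ≤ 1`). [cite: SilvermanAEC2009, VII.3 Prop. 3.1(a) (PDF p. 171)] -/
theorem eq_zero_of_nsmul_eq_zero_of_reducesToZero {N : ℕ} (hN : IsUnit (N : R))
    {P : (W₀.baseChange L).toAffine.Point} (hP : W₀.ReducesToZero P) (h0 : N • P = 0) :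
    P = 0 := by
  obtain ⟨w, hw⟩ := exists_integers L R
  haveI : (W₀.baseChange L).IsIntegral w.integer :=
    isIntegral_integer_of_baseChange_eq (W₀.baseChange L) L R w hw W₀ rfl
  rcases P with _ | ⟨x, y, h⟩
  · rfl
  · exfalso
    have hx : 1 < w x := (not_mem_range_iff hw).mp ((reducesToZero_some_iff (W := W₀) h).mp hP)
    have hn : w ((N : ℤ) : L) = 1 := by
      rw [Int.cast_natCast, ← map_natCast (algebraMap R L) N]
      exact hw.isUnit_iff_valuation_eq_one.mp hN
    have h0' : (N : ℤ) • (Affine.Point.some x y h) = 0 := by rwa [natCast_zsmul]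
    exact absurd (val_le_one_of_zsmul_eq_zero hn h0') (not_le.mpr hx)

/-- **`E₁(L)` is `N`-divisible for `N ∈ R^×`, `R` complete** (Silverman, *AEC* IV.2.3(b) with
IV.3.2(b) and VII.2.2: `[N] : Ê(𝔪) → Ê(𝔪)` is an isomorphism for `N` prime to the residue
characteristic). The tree's successive approximation `FormalGroupChart.exists_nsmul_eq_of_complete`
on the layer `⊤ ⊆ L`, with the x11b3-p4 GEN 2 inputs: Hensel lift of parameters
(`exists_mem_kernel_zCoord_eq`), completeness (`exists_limit_of_forall_val_sub_le_pow`),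
discreteness (`val_le_val_uniformizer_of_lt_one`).
[cite: SilvermanAEC2009, Prop. IV.2.3(b), Prop. IV.3.2(b) and Prop. VII.2.2 (PDF pp. 116, 170)] -/
theorem exists_nsmul_eq_of_reducesToZero [IsAdicComplete (IsLocalRing.maximalIdeal R) R]
    [hE : (W₀.baseChange L).IsElliptic] {N : ℕ} (hN : IsUnit (N : R))
    {m : (W₀.baseChange L).toAffine.Point} (hm : W₀.ReducesToZero m) :
    ∃ P : (W₀.baseChange L).toAffine.Point, W₀.ReducesToZero P ∧ N • P = m := by
  obtain ⟨w, hw⟩ := exists_integers L R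
  haveI hV₀ : (W₀.baseChange L).IsIntegral w.integer :=
    isIntegral_integer_of_baseChange_eq (W₀.baseChange L) L R w hw W₀ rfl
  haveI hV : ((W₀.baseChange L).baseChange L).IsIntegral w.integer := hV₀
  haveI : ((W₀.baseChange L).baseChange L).IsElliptic := hE
  obtain ⟨ϖ, hϖ⟩ := IsDiscreteValuationRing.exists_irreducible R
  have hϖ1 : w (algebraMap R L ϖ) < 1 :=
    lt_of_le_of_ne (hw.map_le_one ϖ) (by
      rw [Ne, ← hw.isUnit_iff_valuation_eq_one]; exact hϖ.not_isUnit)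
  have hϖ0 : 0 < w (algebraMap R L ϖ) :=
    (Valuation.pos_iff _).mpr (by rw [Ne, map_eq_zero_iff _ hw.hom_inj]; exact hϖ.ne_zero)
  have hNw : w (N : L) = 1 := by
    rw [← map_natCast (algebraMap R L) N]
    exact hw.isUnit_iff_valuation_eq_one.mp hN
  have hmK : m ∈ kernel w ((W₀.baseChange L).baseChange L) :=
    (mem_kernel_iff_reducesToZero R W₀ hw m).mpr hm
  obtain ⟨P, hPK, -, hP⟩ := exists_nsmul_eq_of_complete (E := L) (X := W₀.baseChange L)
    (Kn := (⊤ : IntermediateField L L)) (π := algebraMap R L ϖ) (ρ := w (algebraMap R L ϖ))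
    rfl hϖ0 hϖ1
    (fun x hx ↦ val_le_val_uniformizer_of_lt_one L R w hw hϖ hx)
    (fun z hz ↦ by
      obtain ⟨P, hP, hPz⟩ := exists_mem_kernel_zCoord_eq (W₀.baseChange L) L R w hw hz
      exact ⟨P, hP, map_val_top_surjective (W₀.baseChange L) L P, hPz⟩)
    (fun x hx ↦ by
      obtain ⟨y, hy⟩ :=
        exists_limit_of_forall_val_sub_le_pow L R w hw hϖ (fun r ↦ (x r : L)) hx
      exact ⟨⟨y, IntermediateField.mem_top⟩, hy⟩)
    hNw hmK (map_val_top_surjective (W₀.baseChange L) L m)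
  exact ⟨P, (mem_kernel_iff_reducesToZero R W₀ hw P).mp hPK, hP⟩

/-! ### §2 `E₀(L)` at a CUSP: no `N`-torsion, `N`-divisible -/

/-- A unit of `R` which is a natural number is nonzero in the residue field. [folklore] -/
theorem natCast_residueField_ne_zero {N : ℕ} (hN : IsUnit (N : R)) :
    (N : IsLocalRing.ResidueField R) ≠ 0 := by
  rw [← map_natCast (IsLocalRing.residue R) N, Ne, IsLocalRing.residue_eq_zero_iff,
    IsLocalRing.mem_maximalIdeal, mem_nonunits_iff, not_not]
  exact hN

section Cusp

variable [Finite (IsLocalRing.ResidueField R)]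
  {Γ₀ : Type*} [LinearOrderedCommGroupWithZero Γ₀] {v : Valuation L Γ₀}

/-- **The cusp homomorphism `r : E₀(L) →+ k` with kernel `E₁(L)`** at an additive place (finite,
hence perfect, residue field): Silverman *AEC* VII.2.1 composed with III.2.5(b), in the GEN-2
form `JetchevKummer.exists_addMonoidHom_of_map_eq_singularModel_cusp` on the presentation
`exists_map_residue_eq_singularModel_cusp_of_hasAdditiveReduction`.
[cite: SilvermanAEC2009, VII.2 Prop. 2.1 and Prop. III.2.5(b) (PDF pp. 167, 59)] -/
theorem exists_addMonoidHom_ker_eq_of_hasAdditiveReduction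
    [hadd : (W₀.baseChange L).HasAdditiveReduction R] (hv : v.Integers R) :
    ∃ r : W₀.nonsingularReductionSubgroup hv →+ IsLocalRing.ResidueField R,
      ∀ P : W₀.nonsingularReductionSubgroup hv,
        r P = 0 ↔ W₀.ReducesToZero (P : (W₀.baseChange L).toAffine.Point) := by
  haveI : PerfectField (IsLocalRing.ResidueField R) := PerfectField.ofFinite
  haveI : ((W₀.baseChange L).baseChange L).HasAdditiveReduction R := hadd
  obtain ⟨x₀, y₀, α, hW⟩ :=
    exists_map_residue_eq_singularModel_cusp_of_hasAdditiveReduction (W₀.baseChange L) L R W₀ rfl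
  obtain ⟨r, hr, -⟩ := exists_addMonoidHom_of_map_eq_singularModel_cusp W₀ hv hW
  exact ⟨r, hr⟩

/-- **At a cusp `E₀(L)` has no `N`-torsion for `N ∈ R^×`** (Silverman, *ATAEC* IV.9
Remark 9.2.2: `Ẽ_ns(k) = k⁺` is a `p`-group and `E₁` has no prime-to-`p` torsion): `r(N•P) =
N·r(P) = 0` forces `r(P) = 0`, i.e. `P ∈ E₁(L)`, and `E₁(L)[N] = 0`.
[cite: SilvermanATAEC1994, IV.9 Remark 9.2.2 (PDF p. 340)] -/
theorem eq_zero_of_nsmul_eq_zero_of_hasNonsingularReduction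
    [(W₀.baseChange L).HasAdditiveReduction R] (hv : v.Integers R) {N : ℕ} (hN : IsUnit (N : R))
    {P : (W₀.baseChange L).toAffine.Point} (hP : W₀.HasNonsingularReduction P) (h0 : N • P = 0) :
    P = 0 := by
  obtain ⟨r, hr⟩ := exists_addMonoidHom_ker_eq_of_hasAdditiveReduction R W₀ hv
  set P' : W₀.nonsingularReductionSubgroup hv := ⟨P, hP⟩ with hP'
  have h1 : N • P' = 0 := Subtype.ext (by simpa [hP'] using h0)
  have h2 : (N : IsLocalRing.ResidueField R) * r P' = 0 := by
    rw [← nsmul_eq_mul, ← map_nsmul, h1, map_zero]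
  have h3 : r P' = 0 :=
    (mul_eq_zero.mp h2).resolve_left (natCast_residueField_ne_zero R hN)
  exact eq_zero_of_nsmul_eq_zero_of_reducesToZero R W₀ hN ((hr P').mp h3) h0

/-- **At a cusp `E₀(L)` is `N`-divisible for `N ∈ R^×`, `R` complete** (Silverman, *ATAEC* IV.9
Remark 9.2.2 with *AEC* VII.2.2): with `c = #k`, `N^{c−1} = 1` in `k`, so for `P ∈ E₀(L)` the
point `P − N•(N^{c−2}•P)` lies in the kernel `E₁(L)` of `r`, which is `N`-divisible
(`exists_nsmul_eq_of_reducesToZero`); no surjectivity of the reduction map is needed.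
[cite: SilvermanATAEC1994, IV.9 Remark 9.2.2 (PDF p. 340)] [cite: SilvermanAEC2009, Prop. VII.2.2] -/
theorem exists_nsmul_eq_of_hasNonsingularReduction [IsAdicComplete (IsLocalRing.maximalIdeal R) R]
    [(W₀.baseChange L).IsElliptic] [(W₀.baseChange L).HasAdditiveReduction R] (hv : v.Integers R)
    {N : ℕ} (hN : IsUnit (N : R))
    {P : (W₀.baseChange L).toAffine.Point} (hP : W₀.HasNonsingularReduction P) :
    ∃ Q : (W₀.baseChange L).toAffine.Point, W₀.HasNonsingularReduction Q ∧ N • Q = P := by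
  obtain ⟨r, hr⟩ := exists_addMonoidHom_ker_eq_of_hasAdditiveReduction R W₀ hv
  haveI : Fintype (IsLocalRing.ResidueField R) := Fintype.ofFinite _
  set c : ℕ := Fintype.card (IsLocalRing.ResidueField R) with hc
  have hc2 : 2 ≤ c := by
    have : 1 < c := Fintype.one_lt_card
    omega
  have hNk : (N : IsLocalRing.ResidueField R) ≠ 0 := natCast_residueField_ne_zero R hN
  have hpow : ((N * N ^ (c - 2) : ℕ) : IsLocalRing.ResidueField R) = 1 := by
    rw [show N * N ^ (c - 2) = N ^ (c - 1) by
      rw [← pow_succ']; congr 1; omega]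
    rw [Nat.cast_pow]
    exact FiniteField.pow_card_sub_one_eq_one _ hNk
  set P' : W₀.nonsingularReductionSubgroup hv := ⟨P, hP⟩ with hP'
  -- `T := P − N•(N^{c−2}•P) ∈ E₁(L)`
  set T' : W₀.nonsingularReductionSubgroup hv := P' - (N * N ^ (c - 2)) • P' with hT'
  have hrT : r T' = 0 := by
    rw [hT', map_sub, map_nsmul, nsmul_eq_mul, hpow, one_mul, sub_self]
  have hT0 : W₀.ReducesToZero (T' : (W₀.baseChange L).toAffine.Point) := (hr T').mp hrT
  obtain ⟨S, hS1, hNS⟩ := exists_nsmul_eq_of_reducesToZero R W₀ hN hT0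
  refine ⟨N ^ (c - 2) • P + S, ?_, ?_⟩
  · exact HasNonsingularReduction.add hv
      ((W₀.nonsingularReductionSubgroup hv).nsmul_mem hP _) hS1.hasNonsingularReduction
  · have hTcoe : (T' : (W₀.baseChange L).toAffine.Point) = P - (N * N ^ (c - 2)) • P := by
      simp [hT', hP']
    rw [smul_add, hNS, hTcoe, smul_smul, add_sub_cancel]

end Cusp

/-! ### §3 END: `E(L)[ℓ] ≠ 0 ⟺ [E(L) : E₀(L)] = ℓ` at a cusp with index in `{1, ℓ}` -/

/-- **END (local-group half of `Additive.LocalThreeTorsionIffTamagawaThreeOfIV`).** Let `R` be a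
complete discrete valuation ring with finite residue field, `L = Frac R`, `W₀` an `R`-equation of
an elliptic curve with ADDITIVE reduction, `ℓ` a prime which is a unit of `R`, and suppose the
index `[E(L) : E₀(L)]` (of `W₀.nonsingularReductionSubgroup hv`) is `1` or `ℓ` (e.g. Kodaira type
`IV` / `IV*` with `ℓ = 3`: Silverman *ATAEC* IV.9.4 Steps 5, 8, tree
`localTamagawaNumber_of_kodairaSymbolAt_eq_IV(_star)_holds`). Then **`E(L)` has a point of order
`ℓ` iff `[E(L) : E₀(L)] = ℓ`** — `E₀(L)` being uniquely `ℓ`-divisible (§2),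
`E(L)[ℓ] ≅ (E(L)/E₀(L))[ℓ]` (Silverman *ATAEC* IV.9 Rem. 9.2.2 / Cor. IV.9.2).
[cite: SilvermanATAEC1994, IV.9 Remark 9.2.2 and Cor. IV.9.2 (PDF p. 340)]
[cite: SilvermanAEC2009, VII.2 Prop. 2.1, Prop. VII.2.2, VII.3 Prop. 3.1(a)] -/
theorem exists_ne_zero_and_nsmul_eq_zero_iff_index_eq_of_hasAdditiveReduction
    [IsAdicComplete (IsLocalRing.maximalIdeal R) R] [Finite (IsLocalRing.ResidueField R)]
    [(W₀.baseChange L).IsElliptic] [(W₀.baseChange L).HasAdditiveReduction R]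
    {Γ₀ : Type*} [LinearOrderedCommGroupWithZero Γ₀] {v : Valuation L Γ₀} (hv : v.Integers R)
    {ℓ : ℕ} (hℓ : ℓ.Prime) (hu : IsUnit (ℓ : R))
    (hidx : (W₀.nonsingularReductionSubgroup hv).index = 1 ∨
      (W₀.nonsingularReductionSubgroup hv).index = ℓ) :
    (∃ P : (W₀.baseChange L).toAffine.Point, P ≠ 0 ∧ ℓ • P = 0) ↔
      (W₀.nonsingularReductionSubgroup hv).index = ℓ :=
  AddSubgroup.exists_ne_zero_nsmul_eq_zero_iff_index_eq _ hℓ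
    (fun g hg ↦ by
      obtain ⟨h, hh, hgh⟩ := exists_nsmul_eq_of_hasNonsingularReduction R W₀ hv hu
        ((W₀.mem_nonsingularReductionSubgroup_iff hv).mp hg)
      exact ⟨h, (W₀.mem_nonsingularReductionSubgroup_iff hv).mpr hh, hgh⟩)
    (fun g hg h0 ↦ eq_zero_of_nsmul_eq_zero_of_hasNonsingularReduction R W₀ hv hu
      ((W₀.mem_nonsingularReductionSubgroup_iff hv).mp hg) h0)
    hidx

end Summit.BirchSwinnertonDyer.Rank1Residual.Additive.CuspDivision

end
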